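import Summits.BirchSwinnertonDyer.BirchSwinnertonDyer.Theses.ClassRecordThree

/-!
# Glue item 19527 `ShimuraCurveInputsOfParts` of route K2@3 `ClassRecordThree` (rev 11, D1 Shimura cash-in; by-name
# split of the support `ShimuraCurveInputs`)

The three by-name published inputs (`nonempty_shimuraParametrizationData`, Pasten 2024's Ribet–Takahashi package,
the Shimura-curve Heegner-point Gross–Zagier–Kolyvagin fact), in the gate's order, reassemble the parent conjunction.
Pure logic; planner g24's `plan/glue/` file verbatim (the planner seat does not land proofs by role); any prover hand
lands it `--workitem stmt-BirchSwinnertonDyer-19527`. Nothing mathematical is asserted.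
-/

/-- Glue item stmt-BirchSwinnertonDyer-19527 of route-BirchSwinnertonDyer-ClassRecordThree (rev 11, split gen 1 of
`ShimuraCurveInputs`): the three by-name published inputs reassemble the conjunction. Pure logic. -/
theorem classRecordThree_shimuraCurveInputsOfParts_holds :
    Summit.BirchSwinnertonDyer.BirchSwinnertonDyer.Theses.ClassRecordThree.ShimuraCurveInputsOfParts :=
  fun hJL hRT hHK => ⟨hJL, hRT, hHK⟩
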